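import Mathlib
import Literature.Analysis.FluidPDE.VectorCalculus
import Literature.Analysis.FluidPDE.ClassicalSolution
import Literature.Analysis.FluidPDE.NSVorticity
import HarnessLib

/-!
# Constantin–Ignatova–Vicol 2026: the finite-energy lower bound `γ ≥ 2/5` on the collapse
# exponent of a putative (locally) self-similar Euler blow-up

Named fact (sorry-free `def … : Prop`, D-0014) vendoring **Theorem 2.1** of
P. Constantin, M. Ignatova, V. Vicol, *On putative self-similarity for incompressible 3D Euler*,
arXiv:2602.17570 (February 2026; unrefereed — tagged `claim … under-review`, D-0012), §2
"A lower bound for `γ`", as printed: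

> "Assume the 3D Euler equation has initial data `ω₀ ∈ C¹(ℝ³)` with finite kinetic energy, i.e.
> `u₀ = (−Δ)⁻¹ ∇ × ω₀ ∈ L²(ℝ³)`. Assume that the resulting local-in-time smooth solution blows up
> at some finite time `T_* > 0`. If there exists `γ > 0` such that
> `sup_{t ∈ [0,T_*)} (T_* − t)^{1+γ} ‖∇ω(·,t)‖_{L^∞(ℝ³)} < ∞`, then `γ ≥ 2/5`."

The printed proof (p. 5–6): the vorticity magnitude is transported with the stretching factor
`α`, `∂ₜ|ω| + u·∇|ω| = α|ω|`; splitting the principal-value integral for `α` at scale `R(t)` gives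
`|α_in| ≤ C R ‖∇ω‖_∞`, `|α_out| ≤ C R^{-5/2} ‖u‖_{L²}` (energy conservation), and optimising in
`R` yields `|α| ≤ C (T_* − t)^{−5(1+γ)/7}`, integrable in time iff `γ < 2/5`; then `‖ω(t)‖_∞`
stays bounded and the Beale–Kato–Majda criterion forbids blow-up at `T_*`.

## Rendering

* **Solution class / "blows up".** "The resulting local-in-time smooth solution" and "blows up at
  `T_*`" are understood, exactly as in the tree's Beale–Kato–Majda file `NSVorticity.lean`
  (`beale_kato_majda`, whose criterion is the last step of the printed proof), in the BKM class:
  `(u, p)` is a classical unforced Euler solution on `ℝ³ × [0, T_*)`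
  (`IsClassicalEulerSolutionOn (Ico 0 T) 0 u p`) lying in `⋂ₛ C([0,T'']; H^s)` on every compact
  sub-interval (`HasBoundedSobolevNormsOn (Icc 0 T'') u` for all `T'' < T`), and it does NOT
  continue in the class past `T_*` (`¬ HasSobolevExtensionPast 0 u T`). In this class the
  printed hypotheses hold: `ω₀ = curl (u 0)` is `C¹` (slices are `C^∞`) and the kinetic energy is
  finite (the `n = 0` Sobolev bound) and conserved (classical `H^s` solutions, `s ≥ 3`) — so the
  fact is the printed theorem read in the class in which its proof (energy conservation + BKM)
  operates; nothing weaker is claimed about rougher solutions.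
* **The rate hypothesis** `sup_t (T_*−t)^{1+γ} ‖∇ω(t)‖_{L^∞} < ∞` is rendered pointwise with the
  operator norm of the Fréchet derivative of the (continuous, indeed smooth) vorticity slice
  `curl (u t)`: `∃ M, ∀ t ∈ [0,T_*), ∀ x, (T_*−t)^{1+γ} ‖D(curl (u t))(x)‖ ≤ M` (for continuous
  `∇ω` the pointwise supremum is the `L^∞` norm; real power `Real.rpow` with positive base
  `T_* − t > 0` on `[0, T_*)`).
* Conclusion `2/5 ≤ γ` verbatim. Remark 2.2 (c) (the `L^p` refinement `γ ≥ p/(p+3)`) and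
  (b) (localised hypothesis) are NOT vendored here.

## Use

Grounds the lower edge `2/5 ≤ γ` of the "Euler window" in route VortexLineClock
(`Summit.NavierStokesRegularity.NavierStokesRegularity.Theses.VortexLineClock.TypeIIWindowCore` /
`EmptyEulerWindow`) and the collapse guard-rails quoted by routes DSolutionBubble / CertifiedBlowup
of the same summit. Users take `(h : CIV2026_collapseExponent_ge_two_fifths)` as a hypothesis.

## Search record (grounder, 2026-08-15)

`lean search "Ignatova|2602.17570|EulerProfile|outgoing"`: no CIV statement in the tree;
`lean search "SelfSimilar|IsTypeIBlowup"`: only the Navier–Stokes-scaling (`γ = 1/2`) side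
(`ChaeAsymptoticallySelfSimilar*`, `KNSSTypeII`, `SelfSimilar`); the BKM class and criterion are
`Literature.Analysis.FluidPDE.HasBoundedSobolevNormsOn / HasSobolevExtensionPast / beale_kato_majda`
(`NSVorticity.lean`), reused here verbatim.
-/

noncomputable section

open Set Function
open scoped NNReal

namespace Literature.Analysis.FluidPDE

/-- Local notation for physical space `ℝ³ = EuclideanSpace ℝ (Fin 3)`. -/
local notation "ℝ³" => EuclideanSpace ℝ (Fin 3)

/-- **Constantin–Ignatova–Vicol 2026, Theorem 2.1** (arXiv:2602.17570, §2, p. 5, as printed):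
"Assume the 3D Euler equation has initial data `ω₀ ∈ C¹(ℝ³)` with finite kinetic energy, i.e.
`u₀ = (−Δ)⁻¹∇ × ω₀ ∈ L²(ℝ³)`. Assume that the resulting local-in-time smooth solution blows up at
some finite time `T_* > 0`. If there exists `γ > 0` such that
`sup_{t∈[0,T_*)} (T_* − t)^{1+γ} ‖∇ω(·,t)‖_{L^∞(ℝ³)} < ∞`, then `γ ≥ 2/5`."
Rendered in the Beale–Kato–Majda class of `NSVorticity.lean` (the class in which "local smooth
solution" and "blows up" = "does not continue in the class past `T_*`" are meant, and in which the
printed proof — energy conservation, the stretching-factor bound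
`|α| ≤ C (T_*−t)^{−5(1+γ)/7}`, and the BKM criterion `beale_kato_majda` — runs): a classical
unforced Euler solution `(u, p)` on `ℝ³ × [0, T)`, `T > 0`, with all Sobolev norms bounded on every
compact `[0, T''] ⊆ [0, T)`, no continuation in the class past `T`, and the rate bound on
`∇ω = D(curl (u t))` in operator norm, has `2/5 ≤ γ`. Grounds the lower window edge of
`Summit.NavierStokesRegularity.NavierStokesRegularity.Theses.VortexLineClock.TypeIIWindowCore` /
`EmptyEulerWindow`. Source locator: arXiv:2602.17570, Theorem 2.1 (§2, p. 5). [claim: ConstantinIgnatovaVicol2026Putative, status: under-review] -/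
def CIV2026_collapseExponent_ge_two_fifths : Prop :=
  ∀ ⦃T : ℝ⦄ (_hT : 0 < T) ⦃u : ℝ → ℝ³ → ℝ³⦄ ⦃p : ℝ → ℝ³ → ℝ⦄
    (_hsol : IsClassicalEulerSolutionOn (Ico 0 T) 0 u p)
    (_hreg : ∀ T'' < T, HasBoundedSobolevNormsOn (Icc 0 T'') u)
    (_hblowup : ¬ HasSobolevExtensionPast 0 u T)
    ⦃γ : ℝ⦄ (_hγ : 0 < γ)
    (_hrate : ∃ M : ℝ, ∀ t ∈ Ico 0 T, ∀ x : ℝ³,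
      (T - t) ^ (1 + γ) * ‖fderiv ℝ (curl (u t)) x‖ ≤ M),
    (2 : ℝ) / 5 ≤ γ

end Literature.Analysis.FluidPDE
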